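import Mathlib

/-!
# The one-sided power sum inequality of Lagarias–Montgomery–Odlyzko (Fejér-kernel method)

Topic `Literature/Analysis/Complex`, sub-namespace `PowerSum` (next to
`TuranSecondMainTheorem.lean`, Turán's two-sided theorem `PowerSum.exists_powerSum_ge_max`).
Everything in this file is PROVED (one definition with body, theorems; no named facts).

**Theorem** (Lagarias–Montgomery–Odlyzko 1979, Theorem 4.2, in the sharpened form of Zaman 2017,
Theorem 2.3; here with non-negative real weights, which amounts to repeating nodes).  Let `s` be a
finite set of indices, `z_j ∈ ℂ`, `b_j ≥ 0`, `j₀ ∈ s` with `b_{j₀} > 0`, `z_{j₀} ≠ 0` and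
`|z_j| ≤ |z_{j₀}|` for all `j`.  Put `M = Σ_j b_j |z_j| / (b_{j₀} |z_{j₀}|)` and let `ε > 0`.  Then there
is an integer `m` with `1 ≤ m ≤ (12 + ε) M` and

  `Re Σ_j b_j z_j^m ≥ (ε/(48 + 5ε)) · b_{j₀} |z_{j₀}|^m`        (`exists_re_powerSum_ge`).

Unlike Turán's second main theorem this bounds the REAL PART of the power sum from below, at the
price of starting the range of exponents at `m = 1`; it is the power-sum input of the
Deuring–Heilbronn phenomenon for Hecke `L`-functions (Lagarias–Montgomery–Odlyzko §4–5; Zaman 2017;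
Thorner–Zaman 2017, Theorem 7.1), where the comparison inequality controls only `Re Σ z^m`.

Proof (Zaman 2017, §2.2): with the Fejér weights `w_j = 1 − j/(J+1)` (`1 ≤ j ≤ J`) and
`P(z) = Σ_j w_j Re z^j` (`fejerPoly`) one has `P(z) ≥ −1/2` on `|z| ≤ 1` (Fejér's kernel is
non-negative on `|z| = 1`; minimum principle inside), `P(1) = J/2`, `|P(z)| ≤ (3/2)|z|` for
`|z| ≤ 1/3`.  After normalising `|z_{j₀}| = 1`, the weighted average
`S = Σ_{j ≤ J} w_j Re(s_j)(1 + Re z_{j₀}^j)` equals `Σ_n b_n {P(u_n) + ½P(u_n z_{j₀}) + ½P(u_n z̄_{j₀})}`,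
`u_n = z_n`, which is `≥ b_{j₀}((J+1)/4 − 3M) ≥ b_{j₀} εM/4` for `J = ⌊(12+ε)M⌋`, whereas if every
`Re s_j < c b_{j₀}` (`c = ε/(48+5ε)`) then `S ≤ c b_{j₀} J < b_{j₀} εM/4`.

## References

* J. C. Lagarias, H. L. Montgomery, A. M. Odlyzko, *A bound for the least prime ideal in the
  Chebotarev density theorem*, Invent. Math. 54 (1979) 271–296, Theorem 4.2. [LagariasMontgomeryOdlyzko1979]
* A. Zaman, *Bounding the least prime ideal in the Chebotarev density theorem*, Funct. Approx.
  Comment. Math. 57 (2017) 115–142, Lemma 2.2 and Theorem 2.3 (arXiv:1508.00287, §2.2).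
* J. Thorner, A. Zaman, *An explicit bound for the least prime ideal in the Chebotarev density
  theorem*, Algebra Number Theory 11 (2017), Theorem 7.1. [ThornerZaman2017]
-/

noncomputable section

open Complex Finset Metric

namespace Literature.Analysis.Complex.PowerSum

/-! ### The Fejér kernel polynomial `P_J(z) = Σ_{j=1}^{J} (1 − j/(J+1)) Re z^j` -/

/-- `P_J(z) = Σ_{j<J} (1 − (j+1)/(J+1)) Re(z^{j+1})`. [cite: LagariasMontgomeryOdlyzko1979, Theorem 4.2 (proof)] -/
def fejerPoly (J : ℕ) (z : ℂ) : ℝ :=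
  ∑ j ∈ range J, (1 - ((j : ℝ) + 1) / ((J : ℝ) + 1)) * (z ^ (j + 1)).re

/-- The Fejér weights are non-negative. [folklore] -/
theorem fejerWeight_nonneg {J j : ℕ} (hj : j < J) : 0 ≤ 1 - ((j : ℝ) + 1) / ((J : ℝ) + 1) := by
  rw [sub_nonneg, div_le_one (by positivity)]
  have : (j : ℝ) + 1 ≤ J := by exact_mod_cast hj
  linarith

/-- The Fejér weights are at most `1`. [folklore] -/
theorem fejerWeight_le_one (J j : ℕ) : 1 - ((j : ℝ) + 1) / ((J : ℝ) + 1) ≤ 1 := by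
  have : 0 ≤ ((j : ℝ) + 1) / ((J : ℝ) + 1) := by positivity
  linarith

/-- `Σ_{j<J} (j+1) = J(J+1)/2`. [folklore] -/
private theorem sum_range_natCast_add_one (J : ℕ) : ∑ j ∈ range J, ((j : ℝ) + 1) = (J : ℝ) * ((J : ℝ) + 1) / 2 := by
  induction J with
  | zero => simp
  | succ n ih =>
    rw [sum_range_succ, ih]; push_cast; ring

/-- `Σ_{j<J} (1 − (j+1)/(J+1)) = J/2`. [folklore] -/
theorem sum_fejerWeight (J : ℕ) : ∑ j ∈ range J, (1 - ((j : ℝ) + 1) / ((J : ℝ) + 1)) = (J : ℝ) / 2 := by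
  have hJ : ((J : ℝ) + 1) ≠ 0 := by positivity
  have h1 := sum_range_natCast_add_one J
  rw [sum_sub_distrib, sum_const, card_range, nsmul_eq_mul, mul_one, ← sum_div, h1]
  field_simp
  ring

/-- `P_J(1) = J/2`. [cite: LagariasMontgomeryOdlyzko1979, Theorem 4.2 (proof)] -/
theorem fejerPoly_one (J : ℕ) : fejerPoly J 1 = (J : ℝ) / 2 := by
  unfold fejerPoly
  simp only [one_pow, one_re, mul_one]
  exact sum_fejerWeight J

/-- `P_J(z) ≤ J/2` for `|z| ≤ 1`. [folklore] -/
theorem fejerPoly_le (J : ℕ) {z : ℂ} (hz : ‖z‖ ≤ 1) : fejerPoly J z ≤ (J : ℝ) / 2 := by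
  unfold fejerPoly
  rw [← sum_fejerWeight J]
  refine sum_le_sum fun j hj ↦ ?_
  have hw := fejerWeight_nonneg (mem_range.mp hj)
  have h1 : (z ^ (j + 1)).re ≤ 1 := by
    refine (re_le_norm _).trans ?_
    rw [norm_pow]; exact pow_le_one₀ (norm_nonneg _) hz
  nlinarith

/-- `|P_J(z)| ≤ (3/2)|z|` for `|z| ≤ 1/3` (geometric series). [cite: LagariasMontgomeryOdlyzko1979, Theorem 4.2 (proof)] -/
theorem abs_fejerPoly_le (J : ℕ) {z : ℂ} (hz : ‖z‖ ≤ 1 / 3) : |fejerPoly J z| ≤ 3 / 2 * ‖z‖ := by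
  unfold fejerPoly
  set r : ℝ := ‖z‖ with hr
  have hr0 : 0 ≤ r := norm_nonneg _
  have hterm : ∀ j ∈ range J, |(1 - ((j : ℝ) + 1) / ((J : ℝ) + 1)) * (z ^ (j + 1)).re| ≤ r ^ (j + 1) := by
    intro j hj
    rw [abs_mul, abs_of_nonneg (fejerWeight_nonneg (mem_range.mp hj))]
    have h1 : |(z ^ (j + 1)).re| ≤ r ^ (j + 1) := by
      refine (abs_re_le_norm _).trans ?_; rw [norm_pow]
    calc (1 - ((j : ℝ) + 1) / ((J : ℝ) + 1)) * |(z ^ (j + 1)).re| ≤ 1 * r ^ (j + 1) :=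
          mul_le_mul (fejerWeight_le_one J j) h1 (abs_nonneg _) zero_le_one
      _ = r ^ (j + 1) := one_mul _
  refine (abs_sum_le_sum_abs _ _).trans ((sum_le_sum hterm).trans ?_)
  -- `Σ_{j<J} r^{j+1} = r (1 − r^J)/(1 − r) ≤ r/(1−r) ≤ (3/2) r`
  have hgeom : ∑ j ∈ range J, r ^ (j + 1) = r * ∑ j ∈ range J, r ^ j := by
    rw [mul_sum]; refine sum_congr rfl fun j _ ↦ by ring
  rw [hgeom]
  have hr1 : r < 1 := by linarith
  have hs : ∑ j ∈ range J, r ^ j ≤ (1 - r)⁻¹ := by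
    rw [geom_sum_eq hr1.ne, div_le_iff_of_neg (by linarith)]
    have h1 : (1 - r)⁻¹ * (r - 1) = -1 := by
      have : (1 - r) ≠ 0 := by linarith
      field_simp
      ring
    rw [h1]
    have : 0 ≤ r ^ J := pow_nonneg hr0 J
    linarith
  have h32 : (1 - r)⁻¹ ≤ 3 / 2 := by
    rw [inv_le_comm₀ (by linarith) (by norm_num)]; linarith
  calc r * ∑ j ∈ range J, r ^ j ≤ r * (3 / 2) := mul_le_mul_of_nonneg_left (hs.trans h32) hr0
    _ = 3 / 2 * r := by ring

/-! ### Fejér's kernel is non-negative -/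

/-- **The trigonometric identity behind Fejér's kernel**:
`(J+1) + 2 Σ_{j<J} (J − j) cos((j+1)θ) = (Σ_{j ≤ J} cos jθ)² + (Σ_{j ≤ J} sin jθ)²`. [folklore] -/
theorem fejer_identity (θ : ℝ) (J : ℕ) :
    ((J : ℝ) + 1) + 2 * ∑ j ∈ range J, ((J : ℝ) - j) * Real.cos ((j + 1) * θ) =
      (∑ j ∈ range (J + 1), Real.cos (j * θ)) ^ 2 + (∑ j ∈ range (J + 1), Real.sin (j * θ)) ^ 2 := by
  induction J with
  | zero => simp
  | succ n ih =>
    -- the increment of the right-hand side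
    set C : ℝ := ∑ j ∈ range (n + 1), Real.cos (j * θ) with hC
    set S : ℝ := ∑ j ∈ range (n + 1), Real.sin (j * θ) with hS
    have hc : Real.cos (((n + 1 : ℕ) : ℝ) * θ) = Real.cos (((n : ℝ) + 1) * θ) := by push_cast; ring_nf
    have hs : Real.sin (((n + 1 : ℕ) : ℝ) * θ) = Real.sin (((n : ℝ) + 1) * θ) := by push_cast; ring_nf
    rw [sum_range_succ _ (n + 1), sum_range_succ _ (n + 1), ← hC, ← hS, hc, hs]
    -- `2 (C cos((n+1)θ) + S sin((n+1)θ)) = 2 Σ_{j ≤ n} cos((n+1−j)θ) = 2 Σ_{j<n+1} cos((j+1)θ)`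
    have hcross : C * Real.cos (((n : ℝ) + 1) * θ) + S * Real.sin (((n : ℝ) + 1) * θ) =
        ∑ j ∈ range (n + 1), Real.cos ((j + 1) * θ) := by
      rw [hC, hS, sum_mul, sum_mul, ← sum_add_distrib]
      have h1 : ∀ j ∈ range (n + 1), Real.cos (j * θ) * Real.cos (((n : ℝ) + 1) * θ) +
          Real.sin (j * θ) * Real.sin (((n : ℝ) + 1) * θ) = Real.cos ((((n - j : ℕ) : ℝ) + 1) * θ) := by
        intro j hj
        have hjn : j ≤ n := Nat.lt_succ_iff.mp (mem_range.mp hj)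
        rw [mul_comm (Real.cos (j * θ)), mul_comm (Real.sin (j * θ)), ← Real.cos_sub]
        congr 1
        push_cast [hjn]
        ring
      rw [sum_congr rfl h1]
      exact sum_range_reflect (fun j ↦ Real.cos (((j : ℝ) + 1) * θ)) (n + 1)
    -- the increment of the left-hand side
    have hleft : ∑ j ∈ range (n + 1), (((n + 1 : ℕ) : ℝ) - j) * Real.cos ((j + 1) * θ) =
        ∑ j ∈ range n, ((n : ℝ) - j) * Real.cos ((j + 1) * θ) +
          ∑ j ∈ range (n + 1), Real.cos ((j + 1) * θ) := by
      have e : ∀ j ∈ range (n + 1), (((n + 1 : ℕ) : ℝ) - j) * Real.cos ((j + 1) * θ) =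
          ((n : ℝ) - j) * Real.cos ((j + 1) * θ) + Real.cos ((j + 1) * θ) := by
        intro j _; push_cast; ring
      rw [sum_congr rfl e, sum_add_distrib, sum_range_succ (fun j ↦ ((n : ℝ) - j) * Real.cos ((j + 1) * θ)) n]
      simp
    rw [hleft]
    have hsc := Real.sin_sq_add_cos_sq (((n : ℝ) + 1) * θ)
    push_cast
    linear_combination ih - 2 * hcross - hsc

/-- **Fejér positivity on the unit circle**: `1 + 2 P_J(z) ≥ 0` for `|z| = 1`. [folklore] -/
theorem one_add_two_mul_fejerPoly_nonneg (J : ℕ) {z : ℂ} (hz : ‖z‖ = 1) : 0 ≤ 1 + 2 * fejerPoly J z := by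
  obtain ⟨θ, rfl⟩ := (Complex.norm_eq_one_iff z).mp hz
  have hre : ∀ j : ℕ, ((Complex.exp (θ * I)) ^ (j + 1)).re = Real.cos (((j : ℝ) + 1) * θ) := by
    intro j
    rw [← Complex.exp_nat_mul, show ((j + 1 : ℕ) : ℂ) * (θ * I) = ((((j : ℝ) + 1) * θ : ℝ) : ℂ) * I by
      push_cast; ring, Complex.exp_ofReal_mul_I_re]
  have hJ : (0 : ℝ) < (J : ℝ) + 1 := by positivity
  have key : 1 + 2 * fejerPoly J (Complex.exp (θ * I)) =
      (((J : ℝ) + 1) + 2 * ∑ j ∈ range J, ((J : ℝ) - j) * Real.cos ((j + 1) * θ)) / ((J : ℝ) + 1) := by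
    unfold fejerPoly
    simp_rw [hre]
    rw [eq_div_iff hJ.ne', add_mul, one_mul, mul_assoc, sum_mul]
    congr 2
    refine sum_congr rfl fun j _ ↦ ?_
    field_simp
    ring
  rw [key, fejer_identity]
  positivity

/-- **`P_J(z) ≥ −1/2` for `|z| ≤ 1`** (minimum principle for the harmonic function `P_J = Re p_J`:
the maximum modulus principle for `exp(−p_J)` on the unit disc). [cite: LagariasMontgomeryOdlyzko1979, Theorem 4.2 (proof)] -/
theorem fejerPoly_ge_neg_half (J : ℕ) {z : ℂ} (hz : ‖z‖ ≤ 1) : -(1 / 2) ≤ fejerPoly J z := by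
  set p : ℂ → ℂ := fun w ↦ ∑ j ∈ range J, ((1 - ((j : ℝ) + 1) / ((J : ℝ) + 1) : ℝ) : ℂ) * w ^ (j + 1)
    with hp
  have hre : ∀ w : ℂ, (p w).re = fejerPoly J w := by
    intro w
    rw [hp]; dsimp only
    rw [Complex.re_sum, fejerPoly]
    refine sum_congr rfl fun j _ ↦ ?_
    rw [Complex.re_ofReal_mul]
  set f : ℂ → ℂ := fun w ↦ Complex.exp (-p w) with hf
  have hfd : Differentiable ℂ f := by
    rw [hf, hp]
    fun_prop
  have hnorm : ∀ w, ‖f w‖ = Real.exp (-fejerPoly J w) := by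
    intro w
    rw [hf]; dsimp only
    rw [Complex.norm_exp, Complex.neg_re, hre]
  have hfront : ∀ w ∈ frontier (ball (0 : ℂ) 1), ‖f w‖ ≤ Real.exp (1 / 2) := by
    intro w hw
    rw [frontier_ball (0 : ℂ) one_ne_zero, mem_sphere_zero_iff_norm] at hw
    rw [hnorm]
    exact Real.exp_le_exp.mpr (by linarith [one_add_two_mul_fejerPoly_nonneg J hw])
  have hcl : z ∈ closure (ball (0 : ℂ) 1) := by
    rw [closure_ball (0 : ℂ) one_ne_zero, mem_closedBall_zero_iff]; exact hz
  have h := Complex.norm_le_of_forall_mem_frontier_norm_le isBounded_ball hfd.diffContOnCl hfront hcl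
  rw [hnorm, Real.exp_le_exp] at h
  linarith

/-- The three-term kernel bound for a general node: for `|u| ≤ 1` and `|u₀| = 1`,
`P(u) + ½P(u u₀) + ½P(u ū₀) ≥ −3|u|`. [cite: LagariasMontgomeryOdlyzko1979, Theorem 4.2 (proof)] -/
theorem threeTerm_ge (J : ℕ) {u u₀ : ℂ} (hu : ‖u‖ ≤ 1) (hu₀ : ‖u₀‖ = 1) :
    -(3 * ‖u‖) ≤ fejerPoly J u + 1 / 2 * fejerPoly J (u * u₀) + 1 / 2 * fejerPoly J (u * (starRingEnd ℂ) u₀) := by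
  have hn1 : ‖u * u₀‖ = ‖u‖ := by rw [norm_mul, hu₀, mul_one]
  have hn2 : ‖u * (starRingEnd ℂ) u₀‖ = ‖u‖ := by rw [norm_mul, Complex.norm_conj, hu₀, mul_one]
  by_cases h3 : ‖u‖ ≤ 1 / 3
  · have e1 := abs_fejerPoly_le J h3
    have e2 := abs_fejerPoly_le J (show ‖u * u₀‖ ≤ 1 / 3 by rw [hn1]; exact h3)
    have e3 := abs_fejerPoly_le J (show ‖u * (starRingEnd ℂ) u₀‖ ≤ 1 / 3 by rw [hn2]; exact h3)
    rw [hn1] at e2; rw [hn2] at e3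
    have := neg_abs_le (fejerPoly J u)
    have := neg_abs_le (fejerPoly J (u * u₀))
    have := neg_abs_le (fejerPoly J (u * (starRingEnd ℂ) u₀))
    linarith
  · push Not at h3
    have e1 := fejerPoly_ge_neg_half J hu
    have e2 := fejerPoly_ge_neg_half J (show ‖u * u₀‖ ≤ 1 by rw [hn1]; exact hu)
    have e3 := fejerPoly_ge_neg_half J (show ‖u * (starRingEnd ℂ) u₀‖ ≤ 1 by rw [hn2]; exact hu)
    linarith

/-- The three-term kernel at the top node: for `|u₀| = 1`,
`P(u₀) + ½P(u₀²) + ½P(1) ≥ J/4 − 3/4`. [cite: LagariasMontgomeryOdlyzko1979, Theorem 4.2 (proof)] -/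
theorem threeTerm_top_ge (J : ℕ) {u₀ : ℂ} (hu₀ : ‖u₀‖ = 1) :
    (J : ℝ) / 4 - 3 / 4 ≤
      fejerPoly J u₀ + 1 / 2 * fejerPoly J (u₀ * u₀) + 1 / 2 * fejerPoly J (u₀ * (starRingEnd ℂ) u₀) := by
  have h1 : u₀ * (starRingEnd ℂ) u₀ = 1 := by
    rw [Complex.mul_conj, Complex.normSq_eq_norm_sq, hu₀]; norm_num
  rw [h1, fejerPoly_one]
  have e1 := fejerPoly_ge_neg_half J hu₀.le
  have e2 := fejerPoly_ge_neg_half J (show ‖u₀ * u₀‖ ≤ 1 by rw [norm_mul, hu₀]; norm_num)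
  linarith

/-! ### The one-sided power sum inequality -/

/-- `Re a · Re b = (Re(ab) + Re(a b̄))/2`. [folklore] -/
theorem re_mul_re_eq (a b : ℂ) : a.re * b.re = ((a * b).re + (a * (starRingEnd ℂ) b).re) / 2 := by
  simp only [Complex.mul_re, Complex.conj_re, Complex.conj_im]; ring

set_option maxHeartbeats 800000 in
/-- **The one-sided power sum inequality** (Lagarias–Montgomery–Odlyzko 1979, Thm. 4.2; Zaman 2017,
Thm. 2.3, with weights).  Let `b_j ≥ 0`, `b_{j₀} > 0`, `z_{j₀} ≠ 0`, `|z_j| ≤ |z_{j₀}|` (`j ∈ s`), `ε > 0`,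
and `M = Σ_{j∈s} b_j|z_j| / (b_{j₀}|z_{j₀}|)`.  Then there is a natural number `m` with `1 ≤ m ≤ (12+ε)M`
and `(ε/(48+5ε)) b_{j₀} |z_{j₀}|^m ≤ Re Σ_{j∈s} b_j z_j^m`.
[cite: LagariasMontgomeryOdlyzko1979, Theorem 4.2] [cite: ThornerZaman2017, Theorem 7.1] -/
theorem exists_re_powerSum_ge {ι : Type*} (s : Finset ι) (z : ι → ℂ) (b : ι → ℝ)
    (hb : ∀ j ∈ s, 0 ≤ b j) {j₀ : ι} (hj₀ : j₀ ∈ s) (hb₀ : 0 < b j₀)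
    (hmax : ∀ j ∈ s, ‖z j‖ ≤ ‖z j₀‖) (hz₀ : z j₀ ≠ 0) {ε : ℝ} (hε : 0 < ε) :
    ∃ m : ℕ, 1 ≤ m ∧ (m : ℝ) ≤ (12 + ε) * ((∑ j ∈ s, b j * ‖z j‖) / (b j₀ * ‖z j₀‖)) ∧
      ε / (48 + 5 * ε) * b j₀ * ‖z j₀‖ ^ m ≤ (∑ j ∈ s, (b j : ℂ) * z j ^ m).re := by
  classical
  set R : ℝ := ‖z j₀‖ with hR
  have hR0 : 0 < R := norm_pos_iff.mpr hz₀
  have hRc : (R : ℂ) ≠ 0 := by exact_mod_cast hR0.ne'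
  set u : ι → ℂ := fun j ↦ z j / R with hu
  have hu1 : ∀ j ∈ s, ‖u j‖ ≤ 1 := by
    intro j hj
    rw [hu]; dsimp only
    rw [norm_div, Complex.norm_real, Real.norm_of_nonneg hR0.le, div_le_one hR0]
    exact hmax j hj
  have hu₀ : ‖u j₀‖ = 1 := by
    rw [hu]; dsimp only
    rw [norm_div, Complex.norm_real, Real.norm_of_nonneg hR0.le, ← hR, div_self hR0.ne']
  have hzu : ∀ j (m : ℕ), z j ^ m = (R : ℂ) ^ m * u j ^ m := by
    intro j m
    rw [hu]; dsimp only
    rw [div_pow, mul_div_cancel₀ _ (pow_ne_zero _ hRc)]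
  set M : ℝ := (∑ j ∈ s, b j * ‖z j‖) / (b j₀ * R) with hM
  -- `M = Σ b_j |u_j| / b₀ ≥ 1`
  have hMu : M * b j₀ = ∑ j ∈ s, b j * ‖u j‖ := by
    rw [hM]
    have e : ∑ j ∈ s, b j * ‖u j‖ = (∑ j ∈ s, b j * ‖z j‖) / R := by
      rw [sum_div]
      refine sum_congr rfl fun j _ ↦ ?_
      rw [hu]; dsimp only
      rw [norm_div, Complex.norm_real, Real.norm_of_nonneg hR0.le]; ring
    rw [e]
    field_simp
  have hM1 : 1 ≤ M := by
    have h1 : b j₀ * ‖u j₀‖ ≤ ∑ j ∈ s, b j * ‖u j‖ :=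
      single_le_sum (f := fun j ↦ b j * ‖u j‖) (fun j hj ↦ mul_nonneg (hb j hj) (norm_nonneg _)) hj₀
    rw [hu₀, mul_one, ← hMu] at h1
    nlinarith
  have hM0 : 0 < M := by linarith
  -- `J = ⌊(12+ε)M⌋`
  set J : ℕ := ⌊(12 + ε) * M⌋₊ with hJ
  have hJle : (J : ℝ) ≤ (12 + ε) * M := Nat.floor_le (by positivity)
  have hJgt : (12 + ε) * M < J + 1 := Nat.lt_floor_add_one _
  have hJ1 : 1 ≤ J := by
    have : (12 : ℝ) ≤ (12 + ε) * M := by nlinarith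
    have h12 : (12 : ℝ) - 1 < J := by linarith
    exact_mod_cast (show (1 : ℝ) ≤ J by linarith)
  set c : ℝ := ε / (48 + 5 * ε) with hc
  have hc0 : 0 < c := by positivity
  -- suppose the conclusion fails for every `m ≤ J`
  by_contra hcon
  push Not at hcon
  have hsmall : ∀ m ∈ range J, (∑ j ∈ s, (b j : ℂ) * u j ^ (m + 1)).re < c * b j₀ := by
    intro m hm
    have hm' : m + 1 ≤ J := mem_range.mp hm
    have h := hcon (m + 1) (by omega) ((show ((m + 1 : ℕ) : ℝ) ≤ J by exact_mod_cast hm').trans hJle)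
    have e : (∑ j ∈ s, (b j : ℂ) * z j ^ (m + 1)).re = R ^ (m + 1) * (∑ j ∈ s, (b j : ℂ) * u j ^ (m + 1)).re := by
      rw [show (R ^ (m + 1) : ℝ) * (∑ j ∈ s, (b j : ℂ) * u j ^ (m + 1)).re =
        ((((R ^ (m + 1) : ℝ) : ℂ)) * ∑ j ∈ s, (b j : ℂ) * u j ^ (m + 1)).re by
          rw [Complex.re_ofReal_mul], mul_sum]
      congr 1
      refine sum_congr rfl fun j _ ↦ ?_
      rw [hzu j (m + 1)]; push_cast; ring
    rw [e, hR] at h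
    have hRm : 0 < R ^ (m + 1) := pow_pos hR0 _
    rw [hR] at hRm
    by_contra hge
    push Not at hge
    have := mul_le_mul_of_nonneg_left hge hRm.le
    linarith
  -- the weighted average `S`
  set w : ℕ → ℝ := fun m ↦ 1 - ((m : ℝ) + 1) / ((J : ℝ) + 1) with hw
  set S : ℝ := ∑ m ∈ range J, w m * (∑ j ∈ s, (b j : ℂ) * u j ^ (m + 1)).re * (1 + (u j₀ ^ (m + 1)).re)
    with hSdef
  -- (1) `S` in terms of the kernel
  have hS_eq : S = ∑ j ∈ s, b j * (fejerPoly J (u j) + 1 / 2 * fejerPoly J (u j * u j₀) +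
      1 / 2 * fejerPoly J (u j * (starRingEnd ℂ) (u j₀))) := by
    rw [hSdef]
    have e1 : ∀ m ∈ range J, w m * (∑ j ∈ s, (b j : ℂ) * u j ^ (m + 1)).re * (1 + (u j₀ ^ (m + 1)).re) =
        ∑ j ∈ s, b j * (w m * ((u j ^ (m + 1)).re + 1 / 2 * ((u j * u j₀) ^ (m + 1)).re +
          1 / 2 * ((u j * (starRingEnd ℂ) (u j₀)) ^ (m + 1)).re)) := by
      intro m _
      rw [Complex.re_sum, mul_sum, sum_mul]
      refine sum_congr rfl fun j _ ↦ ?_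
      rw [Complex.re_ofReal_mul]
      have h2 := re_mul_re_eq (u j ^ (m + 1)) (u j₀ ^ (m + 1))
      rw [← mul_pow, map_pow, ← mul_pow] at h2
      have h3 : (u j ^ (m + 1)).re * (1 + (u j₀ ^ (m + 1)).re) =
          (u j ^ (m + 1)).re + 1 / 2 * ((u j * u j₀) ^ (m + 1)).re +
            1 / 2 * ((u j * (starRingEnd ℂ) (u j₀)) ^ (m + 1)).re := by
        rw [mul_add, mul_one, h2]; ring
      calc w m * (b j * (u j ^ (m + 1)).re) * (1 + (u j₀ ^ (m + 1)).re)
          = b j * (w m * ((u j ^ (m + 1)).re * (1 + (u j₀ ^ (m + 1)).re))) := by ring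
        _ = _ := by rw [h3]
    rw [sum_congr rfl e1, sum_comm]
    refine sum_congr rfl fun j _ ↦ ?_
    rw [← mul_sum]
    congr 1
    simp only [fejerPoly, hw]
    rw [mul_sum, mul_sum, ← sum_add_distrib, ← sum_add_distrib]
    refine sum_congr rfl fun m _ ↦ ?_
    ring
  -- (2) the lower bound
  have hS_ge : b j₀ * (ε * M / 4) ≤ S := by
    rw [hS_eq, ← Finset.add_sum_erase _ _ hj₀]
    have htop := threeTerm_top_ge J hu₀
    have hrest : ∀ j ∈ s.erase j₀, b j * (-(3 * ‖u j‖)) ≤ b j * (fejerPoly J (u j) +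
        1 / 2 * fejerPoly J (u j * u j₀) + 1 / 2 * fejerPoly J (u j * (starRingEnd ℂ) (u j₀))) := by
      intro j hj
      have hj' := mem_of_mem_erase hj
      exact mul_le_mul_of_nonneg_left (threeTerm_ge J (hu1 j hj') hu₀) (hb j hj')
    have hsum_rest := sum_le_sum hrest
    have herase : ∑ j ∈ s.erase j₀, b j * (-(3 * ‖u j‖)) = -3 * (M * b j₀ - b j₀) := by
      have h1 : ∑ j ∈ s.erase j₀, b j * ‖u j‖ = M * b j₀ - b j₀ := by
        rw [hMu, ← Finset.add_sum_erase _ _ hj₀, hu₀, mul_one]; ring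
      rw [← h1, mul_sum]
      refine sum_congr rfl fun j _ ↦ by ring
    rw [herase] at hsum_rest
    have h1 : b j₀ * ((J : ℝ) / 4 - 3 / 4) ≤ b j₀ * (fejerPoly J (u j₀) + 1 / 2 * fejerPoly J (u j₀ * u j₀) +
        1 / 2 * fejerPoly J (u j₀ * (starRingEnd ℂ) (u j₀))) := mul_le_mul_of_nonneg_left htop hb₀.le
    have h2 : b j₀ * (ε * M / 4) ≤ b j₀ * ((J : ℝ) / 4 - 3 / 4) + -3 * (M * b j₀ - b j₀) := by
      have key : ε * M / 4 ≤ (J : ℝ) / 4 - 3 / 4 + (-3) * (M - 1) := by linarith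
      have := mul_le_mul_of_nonneg_left key hb₀.le
      linarith
    linarith
  -- (3) the upper bound
  have hS_le : S ≤ c * b j₀ * J := by
    have hterm : ∀ m ∈ range J, w m * (∑ j ∈ s, (b j : ℂ) * u j ^ (m + 1)).re * (1 + (u j₀ ^ (m + 1)).re) ≤
        c * b j₀ * (w m * (1 + (u j₀ ^ (m + 1)).re)) := by
      intro m hm
      have hwm : 0 ≤ w m := fejerWeight_nonneg (mem_range.mp hm)
      have hpos : 0 ≤ 1 + (u j₀ ^ (m + 1)).re := by
        have h1 : |(u j₀ ^ (m + 1)).re| ≤ 1 := by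
          refine (abs_re_le_norm _).trans ?_
          rw [norm_pow, hu₀, one_pow]
        have := neg_abs_le (u j₀ ^ (m + 1)).re
        linarith
      have h := hsmall m hm
      have := mul_le_mul_of_nonneg_left h.le (mul_nonneg hwm hpos)
      nlinarith
    refine (sum_le_sum hterm).trans ?_
    rw [← mul_sum]
    have hsum : ∑ m ∈ range J, w m * (1 + (u j₀ ^ (m + 1)).re) = (J : ℝ) / 2 + fejerPoly J (u j₀) := by
      rw [fejerPoly, ← sum_fejerWeight J, ← sum_add_distrib]
      refine sum_congr rfl fun m _ ↦ ?_
      simp only [hw]; ring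
    rw [hsum]
    have hP := fejerPoly_le J hu₀.le
    have : (J : ℝ) / 2 + fejerPoly J (u j₀) ≤ J := by linarith
    exact mul_le_mul_of_nonneg_left this (by positivity)
  -- (4) contradiction: `c J ≤ c (12+ε) M < ε M /4`
  have hcJ : c * b j₀ * J < b j₀ * (ε * M / 4) := by
    have h1 : c * (12 + ε) < ε / 4 := by
      rw [hc, div_mul_eq_mul_div, div_lt_div_iff₀ (by positivity) (by norm_num)]
      nlinarith
    have h2 : c * (J : ℝ) ≤ c * ((12 + ε) * M) := mul_le_mul_of_nonneg_left hJle hc0.le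
    have h3 : c * (12 + ε) * M < ε / 4 * M := mul_lt_mul_of_pos_right h1 hM0
    have h4 : c * (J : ℝ) < ε * M / 4 := by linarith
    have h5 := mul_lt_mul_of_pos_left h4 hb₀
    linarith
  linarith

end Literature.Analysis.Complex.PowerSum

end
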